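import Mathlib
import HarnessLib

/-!
# Order bookkeeping for `I / Ψ` (route `IrreducibilityBySelfDuality`, input `PairLBoundaryJS`)

Helper for item stmt-Langlands-13622 (Jacquet–Shalika boundary theorem for the partial
Rankin–Selberg product `L^S = I / Ψ`, global integral over local integrals), card
"archimedean equal rank, ord ≤ 0": dividing a function `I` analytic at `s₀` by a function `Ψ`
meromorphic at `s₀` WITHOUT A ZERO beyond its pole there (`meromorphicOrderAt Ψ s₀ ≤ 0`)
introduces no pole at `s₀`, i.e. `0 ≤ meromorphicOrderAt (I / Ψ) s₀`.

This is pure order arithmetic in Mathlib's meromorphic API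
(`meromorphicOrderAt_div`, `AnalyticAt.meromorphicOrderAt_nonneg`) followed by the
inequality `0 ≤ a`, `b ≤ 0 ⇒ 0 ≤ a - b` in `WithTop ℤ`.
-/

noncomputable section

-- `Summit.Langlands.Langlands.…` (summit = sub-problem name, D-0017 layout) trips `dupNamespace`
set_option linter.dupNamespace false

namespace Summit.Langlands.Langlands.Theorems

/-- **Order bookkeeping ("ord ≤ 0 suffices").** Division by a function that is meromorphic
WITHOUT A ZERO at `s₀` introduces no pole at `s₀`: the order of `fun s => I s / Ψ s` at `s₀` is
non-negative whenever `I` is analytic at `s₀`, `Ψ` is meromorphic at `s₀` and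
`meromorphicOrderAt Ψ s₀ ≤ 0`. -/
theorem meromorphicOrderAt_div_nonneg {I Ψ : ℂ → ℂ} {s₀ : ℂ} (hI : AnalyticAt ℂ I s₀)
    (hΨ : MeromorphicAt Ψ s₀) (hord : meromorphicOrderAt Ψ s₀ ≤ 0) :
    0 ≤ meromorphicOrderAt (fun s => I s / Ψ s) s₀ := by
  have hdiv : (fun s => I s / Ψ s) = I / Ψ := rfl
  rw [hdiv, meromorphicOrderAt_div hI.meromorphicAt hΨ]
  have h0 : 0 ≤ meromorphicOrderAt I s₀ := hI.meromorphicOrderAt_nonneg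
  cases ha : meromorphicOrderAt I s₀ with
  | top => simp
  | coe a =>
    cases hb : meromorphicOrderAt Ψ s₀ with
    | top => simp [hb] at hord
    | coe b =>
      rw [ha] at h0
      rw [hb] at hord
      rw [← WithTop.LinearOrderedAddCommGroup.coe_sub]
      have h0' : (0 : ℤ) ≤ a := by exact_mod_cast h0
      have hb' : b ≤ 0 := by exact_mod_cast hord
      exact_mod_cast (by omega : (0 : ℤ) ≤ a - b)

end Summit.Langlands.Langlands.Theorems

end
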